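import Summits.Ventures.YMGap.Thresholds.TorusStateResponseBoundSUN
import Summits.Ventures.YMGap.Thresholds.StarMassGapDimRows
import HarnessLib

/-!
# Venture YMGap — every `SU(N)`, EVERY DIMENSION `d`: uniform bound on the coupling derivative of the torus states from
# a one-link modulus — one term, the response sum, uniform windows and uniqueness below `b₁`

HONEST FRAMING: venture file of the cell `pub-ymgap` (QuantumFields programme), seat ds-1; the general-`d` form of
`TorusStateResponseBoundSUN` (`d = 4`).  Strong-coupling LATTICE statements for `SU(N)` lattice Yang–Mills on `ℤ^d`,
Wilson action at tree coupling `b`, inside the one-sided vertex-star window generated by `OneLinkKRModulus N R K`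
(ds-4/ds-1 general-`d` Lemma G `StarLemmaGDimSUN.star_window_of_oneLinkKRModulus`, door `P_d(K b₁/N) < 1`, received
sum `R_G^{(d)}`); Lipschitz statements in the coupling; nothing about the continuum, confinement, or the Clay problem.

* `gaugeR_dim_mono` — `R_G^{(d)}(c)` is monotone in `c` below the door;
* `abs_cov_plaquette_torusState_le_dim`, `abs_responseSum_torusState_le_dim` — one term / the whole torus derivative,
  rate `κ_d(ρ) = (1 − ρ)²/(2(4dρ + 1))`, `r = e^{−κ_d/d}`, lattice sums `((1+r)/(1−r))^d`;
* `star_window_uniform_dim` — windows for all `0 ≤ b ≤ b₁` with ONE received sum `R_G^{(d)}(K b₁/N)`;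
* `hasUniqueGibbsMeasure_of_modulus_dim` — DLR uniqueness below `b₁` (from `StarDimMassGap.massGapAt_of_oneLinkKRModulus`).
The Lipschitz statements (torus, `ℤ^d`, hypothesis-free rows) are in the sibling `StateLipschitzStarDim`.

References (mechanism only): R. L. Dobrushin, S. B. Shlosman (1985); H. Shen, R. Zhu, X. Zhu, CMP 400 (2023) Lemma 4.1.
-/

noncomputable section

open MeasureTheory ProbabilityTheory Function Finset Filter Topology Real
open scoped NNReal
open Literature.Probability.LatticeModels (Torus.proj Torus.proj_apply HasUniqueGibbsMeasure)
open Literature.MathematicalPhysics.QuantumLattice (LGConfig ZdEdge ZdPlaquette plaquetteEdges torusLift torusEdge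
  toTorusObservable toTorusObservable_apply fundamentalRep continuous_fundamentalRep ymSpecification ymGibbsMeasures)
open Literature.MathematicalPhysics.QuantumFieldTheory hiding ZdEdge
open Literature.MathematicalPhysics.QuantumFieldTheory.Balaban1983to89.StrongCouplingTorusWindow
open Literature.MathematicalPhysics.QuantumFieldTheory.Balaban1983to89.StrongCouplingDobrushinWindow (OneLinkKRModulus)
open Literature.MathematicalPhysics.QuantumFieldTheory.Balaban1983to89.StrongCouplingKernelWindow (oneLinkKRModulus_SU)
open Summit.Ventures.YMGap.DSWindow (linkEnds vertexStar starWin IsLinkWindowContraction)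
open Summit.Ventures.YMGap.StarResolventDim (Delta gaugeR doorPoly Delta_pos_of_door doorPoly_lt_one_mono gaugeR_lt_one_of_door)
open Summit.Ventures.YMGap.StarLimit (continuous_of_isLipschitzCylinder)
open Summit.Ventures.YMGap.RobustBall (l1 l1_sub_comm numOrient sum_pow_l1_sub_le)
open Summit.Ventures.YMGap.PlaquetteSusceptibility (l1_le_mul_norm)

namespace Summit.Ventures.YMGap.CouplingResponse

variable {d N : ℕ}

/-! ### §1 One term -/

section OneTerm

variable {L : ℕ} [NeZero L]

/-- **One term of the response sum, `SU(N)`.**  Torus `(ℤ/L)^4` carrying a vertex-indexed influence array for the star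
windows of the `SU(N)` Wilson specification at coupling `b` (four clauses, received sums `≤ ρ < 1`); `F` a Lipschitz
cylinder (support `Λ`, constant `K`, links based within `D` of `x₀`), `4D + 4 < L`; `s` a centred lift at `x₀`.  Then
`|Cov_{torusState b L}(F, W_{(s y; i, j)})| ≤ 4(2√N)² e^{κ(D+3)} (#Λ K)(16N³) · (e^{−κ/4})^{‖x₀ − s y‖₁}`, `κ = κ_d(ρ)`
(`StarDimLimit.star_torus_cov_lipschitz` with separation `‖s y − x₀‖_∞ − D − 1`). [folklore] -/
theorem abs_cov_plaquette_torusState_le_dim (hd : 2 ≤ d) (b : ℝ) {ρ : ℝ} (hρ0 : 0 ≤ ρ) (hρ1 : ρ < 1)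
    (hW : ∃ Kw : Site d L → Edge d L → Edge d L → ℝ,
      (∀ s y x, 0 ≤ Kw s y x) ∧ (∀ s y x, Kw s y x ≠ 0 → ∀ w ∈ linkEnds y, torusNorm (s - w) ≤ 1) ∧
      IsLinkWindowContraction (d := d) (L := L) (wilsonPlaqWeight N b) suFrobDist starWin (fun c => Kw c.1) ∧
      ∀ (s : Site d L) (x : Edge d L), x ∈ vertexStar s → ∑ y, Kw s y x ≤ ρ)
    {F : LGConfig d (Matrix.specialUnitaryGroup (Fin N) ℂ) → ℝ} {Λ : Finset (ZdEdge d)} {K : ℝ≥0}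
    (hF : IsLipschitzCylinder (fundamentalRep (Fin N)) F Λ K)
    {x₀ : Literature.Probability.LatticeModels.Site d} {D : ℕ} (hD : ∀ e ∈ Λ, ‖e.1 - x₀‖ ≤ D) (hL : 4 * D + 4 < L)
    {s : Site d L → Literature.Probability.LatticeModels.Site d} (hs : ∀ y, (Torus.proj L (s y) : Site d L) = y)
    (hcen : ∀ y, torusNorm (y - Torus.proj L x₀) = Literature.Probability.LatticeModels.Site.supNorm (s y - x₀))
    (y : Site d L) (p : {p : Fin d × Fin d // p.1 < p.2}) :
    |cov[F, zdPlaquetteObs (fundamentalRep (Fin N)) (s y) p.1.1 p.1.2;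
        torusState (d := d) (fundamentalRep (Fin N)) b L]| ≤
      4 * (2 * Real.sqrt N) ^ 2 * Real.exp (((1 - ρ) ^ 2 / (2 * (2 * ρ * ((2 * d : ℕ) : ℝ) + 1))) * (D + 3)) * ((Λ.card : ℝ) * K) * (16 * (N : ℝ) ^ 3) *
        Real.exp (-(((1 - ρ) ^ 2 / (2 * (2 * ρ * ((2 * d : ℕ) : ℝ) + 1))) / d)) ^ l1 (x₀ - s y) := by
  classical
  haveI : SecondCountableTopology (Matrix (Fin N) (Fin N) ℂ) :=
    inferInstanceAs (SecondCountableTopology (Fin N → Fin N → ℂ))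
  haveI : SecondCountableTopology (Matrix.specialUnitaryGroup (Fin N) ℂ) :=
    Topology.IsEmbedding.subtypeVal.secondCountableTopology
  obtain ⟨Kw, hKw, hKloc, hH1, hsum⟩ := hW
  set q : ZdPlaquette d := (s y, p) with hq
  have hP := isLipschitzCylinder_zdPlaquetteObs (N := N) (d := d) (s y) p.2
  have hPm := hP.measurable
  have hcov : cov[F, zdPlaquetteObs (fundamentalRep (Fin N)) (s y) p.1.1 p.1.2;
      torusState (d := d) (fundamentalRep (Fin N)) b L] =
      cov[toTorusObservable L F, toTorusObservable L (zdPlaquetteObs (fundamentalRep (Fin N)) (s y) p.1.1 p.1.2);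
        wilsonMeasure (d := d) (L := L) (fundamentalRep (Fin N)) b] := by
    rw [torusState, covariance_map hF.measurable.aestronglyMeasurable hPm.aestronglyMeasurable
      (measurable_torusLift L).aemeasurable]
    rfl
  rw [hcov]
  have hinj₁ := torusEdge_injOn_of_norm_le (L := L) hD (by omega)
  have hDq : ∀ e ∈ plaquetteEdges q, ‖e.1 - q.1‖ ≤ ((1 : ℕ) : ℝ) := fun e he => by
    simpa using norm_fst_sub_le_of_mem_plaquetteEdges he
  have hinj₂ := torusEdge_injOn_of_norm_le (L := L) hDq (by omega)
  set n : ℕ := torusNorm (y - Torus.proj L x₀) with hn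
  have hgeom : ∀ a ∈ Λ, ∀ e ∈ plaquetteEdges q,
      n - (D + 1) ≤ torusNorm ((torusEdge L a).1 - (torusEdge L e).1) := by
    intro a ha e he
    have h1 : (torusNorm ((torusEdge L a).1 - (Torus.proj L x₀ : Site d L)) : ℝ) ≤ D := by
      simp only [torusEdge]
      rw [← torusProj_site_sub]
      exact (torusNorm_proj_le_norm L _).trans (hD a ha)
    have h2 : (torusNorm (y - (torusEdge L e).1) : ℝ) ≤ 1 := by
      simp only [torusEdge]
      rw [← hs y, ← torusProj_site_sub]
      refine (torusNorm_proj_le_norm L _).trans ?_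
      have := hDq e he
      rw [hq] at this
      simpa [norm_sub_rev] using this
    have h1' : torusNorm ((torusEdge L a).1 - (Torus.proj L x₀ : Site d L)) ≤ D := by exact_mod_cast h1
    have h2' : torusNorm (y - (torusEdge L e).1) ≤ 1 := by exact_mod_cast h2
    have htri : n ≤ torusNorm (y - (torusEdge L e).1) +
        (torusNorm ((torusEdge L e).1 - (torusEdge L a).1) + torusNorm ((torusEdge L a).1 - Torus.proj L x₀)) :=
      (torusNorm_sub_le _ _ _).trans (Nat.add_le_add_left (torusNorm_sub_le _ _ _) _)
    have hsymm : torusNorm ((torusEdge L e).1 - (torusEdge L a).1) = torusNorm ((torusEdge L a).1 - (torusEdge L e).1) := by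
      rw [← torusNorm_neg, neg_sub]
    omega
  have key := StarDimLimit.star_torus_cov_lipschitz (L := L) b hρ0 hρ1 hKw hKloc hH1 hsum hF hP hinj₁ hinj₂ hgeom
  refine key.trans ?_
  have hκ := StarDimLimit.dimRate_pos (d := d) hρ0 hρ1
  have hcard : (((plaquetteEdges q).card : ℝ) * ((4 * (N : ℝ≥0) ^ 3 : ℝ≥0) : ℝ)) ≤ 16 * (N : ℝ) ^ 3 := by
    have hc : ((plaquetteEdges q).card : ℝ) ≤ 4 := by exact_mod_cast card_plaquetteEdges_le q
    have hN3 : (0 : ℝ) ≤ (N : ℝ) ^ 3 := by positivity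
    push_cast
    nlinarith
  have hexp : Real.exp (-(((1 - ρ) ^ 2 / (2 * (2 * ρ * ((2 * d : ℕ) : ℝ) + 1))) * ((n - (D + 1) - 2 : ℕ) : ℝ))) ≤
      Real.exp (((1 - ρ) ^ 2 / (2 * (2 * ρ * ((2 * d : ℕ) : ℝ) + 1))) * (D + 3)) * Real.exp (-(((1 - ρ) ^ 2 / (2 * (2 * ρ * ((2 * d : ℕ) : ℝ) + 1))) / d)) ^ l1 (x₀ - s y) := by
    rw [← Real.exp_nat_mul, ← Real.exp_add]
    refine Real.exp_le_exp.2 ?_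
    have hsub : (n : ℝ) - (D + 3) ≤ ((n - (D + 1) - 2 : ℕ) : ℝ) := by
      have : (n : ℤ) - (D + 3) ≤ ((n - (D + 1) - 2 : ℕ) : ℤ) := by omega
      exact_mod_cast this
    have hl1 : (l1 (x₀ - s y) : ℝ) ≤ d * n := by
      rw [l1_sub_comm, hn, hcen y, ← Literature.Probability.LatticeModels.Site.norm_eq_supNorm]
      have := l1_le_mul_norm (d := d) (s y - x₀)
      linarith
    have hd0 : (0 : ℝ) < d := by exact_mod_cast (show 0 < d by omega)
    have hκ0 : 0 ≤ ((1 - ρ) ^ 2 / (2 * (2 * ρ * ((2 * d : ℕ) : ℝ) + 1))) := hκ.le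
    have h1 : -(((1 - ρ) ^ 2 / (2 * (2 * ρ * ((2 * d : ℕ) : ℝ) + 1))) / d) * (l1 (x₀ - s y) : ℝ) ≥ -(((1 - ρ) ^ 2 / (2 * (2 * ρ * ((2 * d : ℕ) : ℝ) + 1))) / d) * (d * n) := by
      nlinarith [div_nonneg hκ0 hd0.le]
    have h2 : -(((1 - ρ) ^ 2 / (2 * (2 * ρ * ((2 * d : ℕ) : ℝ) + 1))) / d) * ((d : ℝ) * n) = -(((1 - ρ) ^ 2 / (2 * (2 * ρ * ((2 * d : ℕ) : ℝ) + 1))) * n) := by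
      field_simp
    nlinarith
  have hA : 0 ≤ 4 * (2 * Real.sqrt N) ^ 2 := by positivity
  have hΛK : 0 ≤ (Λ.card : ℝ) * K := by positivity
  calc 4 * (2 * Real.sqrt N) ^ 2 * Real.exp (-(((1 - ρ) ^ 2 / (2 * (2 * ρ * ((2 * d : ℕ) : ℝ) + 1))) * ((n - (D + 1) - 2 : ℕ) : ℝ))) *
        ((Λ.card : ℝ) * K) * (((plaquetteEdges q).card : ℝ) * ((4 * (N : ℝ≥0) ^ 3 : ℝ≥0) : ℝ))
      ≤ 4 * (2 * Real.sqrt N) ^ 2 * (Real.exp (((1 - ρ) ^ 2 / (2 * (2 * ρ * ((2 * d : ℕ) : ℝ) + 1))) * (D + 3)) * Real.exp (-(((1 - ρ) ^ 2 / (2 * (2 * ρ * ((2 * d : ℕ) : ℝ) + 1))) / d)) ^ l1 (x₀ - s y)) *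
        ((Λ.card : ℝ) * K) * (16 * (N : ℝ) ^ 3) := by
        gcongr
  _ = _ := by ring

end OneTerm

/-! ### §2 The response sum, uniformly in the volume -/

section Sum

variable {L : ℕ} [NeZero L]

/-- **Uniform bound on the `SU(N)` torus derivative** `Σ_y Σ_{i<j} N·Cov(F, W_{(s y;i,j)})` (the output of
`hasDerivAt_integral_torusState_SU`): `≤ N · D₄ · A_N ((1+r)/(1−r))^4`, independent of `L`. [folklore] -/
theorem abs_responseSum_torusState_le_dim (hd : 2 ≤ d) (b : ℝ) {ρ : ℝ} (hρ0 : 0 ≤ ρ) (hρ1 : ρ < 1)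
    (hW : ∃ Kw : Site d L → Edge d L → Edge d L → ℝ,
      (∀ s y x, 0 ≤ Kw s y x) ∧ (∀ s y x, Kw s y x ≠ 0 → ∀ w ∈ linkEnds y, torusNorm (s - w) ≤ 1) ∧
      IsLinkWindowContraction (d := d) (L := L) (wilsonPlaqWeight N b) suFrobDist starWin (fun c => Kw c.1) ∧
      ∀ (s : Site d L) (x : Edge d L), x ∈ vertexStar s → ∑ y, Kw s y x ≤ ρ)
    {F : LGConfig d (Matrix.specialUnitaryGroup (Fin N) ℂ) → ℝ} {Λ : Finset (ZdEdge d)} {K : ℝ≥0}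
    (hF : IsLipschitzCylinder (fundamentalRep (Fin N)) F Λ K)
    {x₀ : Literature.Probability.LatticeModels.Site d} {D : ℕ} (hD : ∀ e ∈ Λ, ‖e.1 - x₀‖ ≤ D) (hL : 4 * D + 4 < L)
    {s : Site d L → Literature.Probability.LatticeModels.Site d} (hs : ∀ y, (Torus.proj L (s y) : Site d L) = y)
    (hcen : ∀ y, torusNorm (y - Torus.proj L x₀) = Literature.Probability.LatticeModels.Site.supNorm (s y - x₀)) :
    |∑ y : Site d L, ∑ p : {p : Fin d × Fin d // p.1 < p.2},
        (N : ℝ) * cov[F, zdPlaquetteObs (fundamentalRep (Fin N)) (s y) p.1.1 p.1.2;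
          torusState (d := d) (fundamentalRep (Fin N)) b L]| ≤
      N * (numOrient d * (4 * (2 * Real.sqrt N) ^ 2 * Real.exp (((1 - ρ) ^ 2 / (2 * (2 * ρ * ((2 * d : ℕ) : ℝ) + 1))) * (D + 3)) * ((Λ.card : ℝ) * K) *
        (16 * (N : ℝ) ^ 3) * ((1 + Real.exp (-(((1 - ρ) ^ 2 / (2 * (2 * ρ * ((2 * d : ℕ) : ℝ) + 1))) / d))) / (1 - Real.exp (-(((1 - ρ) ^ 2 / (2 * (2 * ρ * ((2 * d : ℕ) : ℝ) + 1))) / d)))) ^ d)) := by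
  classical
  set r : ℝ := Real.exp (-(((1 - ρ) ^ 2 / (2 * (2 * ρ * ((2 * d : ℕ) : ℝ) + 1))) / d)) with hr
  set A : ℝ := 4 * (2 * Real.sqrt N) ^ 2 * Real.exp (((1 - ρ) ^ 2 / (2 * (2 * ρ * ((2 * d : ℕ) : ℝ) + 1))) * (D + 3)) * ((Λ.card : ℝ) * K) * (16 * (N : ℝ) ^ 3)
    with hA
  have hκ := StarDimLimit.dimRate_pos (d := d) hρ0 hρ1
  have hr0 : 0 ≤ r := (Real.exp_pos _).le
  have hd0 : (0 : ℝ) < d := by exact_mod_cast (show 0 < d by omega)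
  have hr1 : r < 1 := Real.exp_lt_one_iff.2 (neg_neg_of_pos (div_pos hκ hd0))
  have hA0 : 0 ≤ A := by positivity
  have hN0 : (0 : ℝ) ≤ N := Nat.cast_nonneg N
  have hterm : ∀ (y : Site d L) (p : {p : Fin d × Fin d // p.1 < p.2}),
      |(N : ℝ) * cov[F, zdPlaquetteObs (fundamentalRep (Fin N)) (s y) p.1.1 p.1.2;
          torusState (d := d) (fundamentalRep (Fin N)) b L]| ≤ N * (A * r ^ l1 (x₀ - s y)) := by
    intro y p
    rw [abs_mul, abs_of_nonneg hN0]
    exact mul_le_mul_of_nonneg_left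
      (abs_cov_plaquette_torusState_le_dim hd b hρ0 hρ1 hW hF hD hL hs hcen y p) hN0
  have hsinj : Function.Injective s := fun y y' h => by rw [← hs y, ← hs y', h]
  calc |∑ y : Site d L, ∑ p : {p : Fin d × Fin d // p.1 < p.2},
          (N : ℝ) * cov[F, zdPlaquetteObs (fundamentalRep (Fin N)) (s y) p.1.1 p.1.2;
            torusState (d := d) (fundamentalRep (Fin N)) b L]|
      ≤ ∑ y : Site d L, ∑ p : {p : Fin d × Fin d // p.1 < p.2},
          |(N : ℝ) * cov[F, zdPlaquetteObs (fundamentalRep (Fin N)) (s y) p.1.1 p.1.2;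
            torusState (d := d) (fundamentalRep (Fin N)) b L]| :=
        (Finset.abs_sum_le_sum_abs _ _).trans (Finset.sum_le_sum fun y _ => Finset.abs_sum_le_sum_abs _ _)
    _ ≤ ∑ y : Site d L, ∑ _p : {p : Fin d × Fin d // p.1 < p.2}, N * (A * r ^ l1 (x₀ - s y)) :=
        Finset.sum_le_sum fun y _ => Finset.sum_le_sum fun p _ => hterm y p
    _ = N * (numOrient d * (A * ∑ y : Site d L, r ^ l1 (x₀ - s y))) := by
        simp only [Finset.sum_const, Finset.card_univ, nsmul_eq_mul, numOrient, Finset.mul_sum]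
        ring
    _ = N * (numOrient d * (A * ∑ x ∈ (Finset.univ : Finset (Site d L)).image s, r ^ l1 (x₀ - x))) := by
        rw [Finset.sum_image fun y _ y' _ h => hsinj h]
    _ ≤ N * (numOrient d * (A * ((1 + r) / (1 - r)) ^ d)) := by
        have := sum_pow_l1_sub_le hr0 hr1 x₀ ((Finset.univ : Finset (Site d L)).image s)
        gcongr

end Sum


/-! ### §3 Windows below `b₁` with one received sum; monotonicity of `R_G^{(d)}` -/

section Window

/-- **`R_G^{(d)}` is monotone below the door**: `0 ≤ c ≤ c'`, `P_d(c') < 1` ⇒ `R_G^{(d)}(c) ≤ R_G^{(d)}(c')`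
(numerator `(2d−2)c(1+c)` increasing, denominator `Δ_d` decreasing and positive). [folklore] -/
theorem gaugeR_dim_mono (hd : 2 ≤ d) {c c' : ℝ} (h0 : 0 ≤ c) (hle : c ≤ c') (hdoor : doorPoly d c' < 1) :
    gaugeR d c ≤ gaugeR d c' := by
  have hd' : (2 : ℝ) ≤ d := by exact_mod_cast hd
  have h0' : 0 ≤ c' := h0.trans hle
  have hΔ' : 0 < Delta d c' := Delta_pos_of_door hd h0' hdoor
  have hΔ : 0 < Delta d c := Delta_pos_of_door hd h0 (doorPoly_lt_one_mono hd h0 hle hdoor)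
  unfold gaugeR
  have hnum : (2 * (d : ℝ) - 2) * c * (1 + c) ≤ (2 * (d : ℝ) - 2) * c' * (1 + c') := by
    have h1 : c * (1 + c) ≤ c' * (1 + c') := by nlinarith
    have h2 : (0 : ℝ) ≤ 2 * d - 2 := by linarith
    calc (2 * (d : ℝ) - 2) * c * (1 + c) = (2 * (d : ℝ) - 2) * (c * (1 + c)) := by ring
      _ ≤ (2 * (d : ℝ) - 2) * (c' * (1 + c')) := mul_le_mul_of_nonneg_left h1 h2
      _ = (2 * (d : ℝ) - 2) * c' * (1 + c') := by ring
  have hnum0 : 0 ≤ (2 * (d : ℝ) - 2) * c' * (1 + c') := mul_nonneg (mul_nonneg (by linarith) h0') (by linarith)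
  have hden : Delta d c' ≤ Delta d c := by
    unfold Delta
    have h3 : c ^ 2 ≤ c' ^ 2 := by nlinarith
    nlinarith [mul_le_mul_of_nonneg_left hle (by linarith : (0 : ℝ) ≤ 2 * d - 4),
      mul_le_mul_of_nonneg_left h3 (by linarith : (0 : ℝ) ≤ 2 * d - 2)]
  exact (div_le_div_of_nonneg_right hnum hΔ.le).trans (div_le_div_of_nonneg_left hnum0 hΔ' hden)

/-- **Uniform star windows from a one-link modulus, dimension `d`**: `OneLinkKRModulus N R K` (`K ≥ 0`),
`2(d−1) b₁/N ≤ R`, `P_d(K b₁/N) < 1` ⇒ for every `0 ≤ b ≤ b₁` and every torus `L ≥ 3` the four window clauses hold with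
the received sum `R_G^{(d)}(K b₁/N)`. [folklore] -/
theorem star_window_uniform_dim {L : ℕ} [NeZero L] (hd : 2 ≤ d) (hL : 3 ≤ L) (hN : 1 ≤ N) {R K b₁ : ℝ} (hK0 : 0 ≤ K)
    (hmod : OneLinkKRModulus N R K) (hR : b₁ / N * (2 * ((d : ℝ) - 1)) ≤ R) (hdoor : doorPoly d (K * (b₁ / N)) < 1)
    {b : ℝ} (h0 : 0 ≤ b) (hb : b ≤ b₁) :
    ∃ Kw : Site d L → Edge d L → Edge d L → ℝ,
      (∀ s y x, 0 ≤ Kw s y x) ∧ (∀ s y x, Kw s y x ≠ 0 → ∀ w ∈ linkEnds y, torusNorm (s - w) ≤ 1) ∧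
      IsLinkWindowContraction (d := d) (L := L) (wilsonPlaqWeight N b) suFrobDist starWin (fun c => Kw c.1) ∧
      ∀ (s : Site d L) (x : Edge d L), x ∈ vertexStar s → ∑ y, Kw s y x ≤ gaugeR d (K * (b₁ / N)) := by
  have hN0 : (0 : ℝ) < N := by exact_mod_cast (show 0 < N by omega)
  have hd' : (2 : ℝ) ≤ d := by exact_mod_cast hd
  have hab : |b| / N = b / N := by rw [abs_of_nonneg h0]
  have hbN : b / N ≤ b₁ / N := div_le_div_of_nonneg_right hb hN0.le
  have hb0N : 0 ≤ b / N := div_nonneg h0 hN0.le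
  have hR' : |b| / N * (2 * ((d : ℝ) - 1)) ≤ R := by
    rw [hab]
    have : b / N * (2 * ((d : ℝ) - 1)) ≤ b₁ / N * (2 * ((d : ℝ) - 1)) := mul_le_mul_of_nonneg_right hbN (by linarith)
    linarith
  have hcle : K * (b / N) ≤ K * (b₁ / N) := mul_le_mul_of_nonneg_left hbN hK0
  have hc0 : 0 ≤ K * (b / N) := mul_nonneg hK0 hb0N
  have hcd : doorPoly d (K * (|b| / N)) < 1 := by
    rw [hab]; exact doorPoly_lt_one_mono hd hc0 hcle hdoor
  obtain ⟨hKw, hKloc, hH1, hH2⟩ := StarLemmaGDimSUN.star_window_of_oneLinkKRModulus (L := L) hd hL hN hK0 hR' hmod hcd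
  refine ⟨_, hKw, hKloc, hH1, fun s x hx => ?_⟩
  rw [hH2 s x hx, hab]
  exact gaugeR_dim_mono hd hc0 hcle hdoor

/-- The uniform received sum is in `[0, 1)`. [folklore] -/
theorem gaugeR_dim_coef_lt_one (hd : 2 ≤ d) {K b₁ : ℝ} (hK0 : 0 ≤ K) (hb₁ : 0 ≤ b₁ / N)
    (hdoor : doorPoly d (K * (b₁ / N)) < 1) :
    0 ≤ gaugeR d (K * (b₁ / N)) ∧ gaugeR d (K * (b₁ / N)) < 1 :=
  gaugeR_lt_one_of_door hd (mul_nonneg hK0 hb₁) hdoor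

/-- DLR uniqueness at every `0 ≤ b ≤ b₁` from the modulus (general `d`): the uniqueness half of
`StarDimMassGap.massGapAt_of_oneLinkKRModulus` at 't Hooft `b/N`. [folklore] -/
theorem hasUniqueGibbsMeasure_of_modulus_dim (hd : 2 ≤ d) (hN : 1 ≤ N) {R K b₁ : ℝ} (hK0 : 0 ≤ K)
    (hmod : OneLinkKRModulus N R K) (hR : b₁ / N * (2 * ((d : ℝ) - 1)) ≤ R) (hdoor : doorPoly d (K * (b₁ / N)) < 1)
    {b : ℝ} (h0 : 0 ≤ b) (hb : b ≤ b₁) :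
    HasUniqueGibbsMeasure (ymSpecification (d := d) (fundamentalRep (Fin N)) b) := by
  have hN0 : (0 : ℝ) < N := by exact_mod_cast (show 0 < N by omega)
  have hd' : (2 : ℝ) ≤ d := by exact_mod_cast hd
  have hab : |b / N| = b / N := abs_of_nonneg (div_nonneg h0 hN0.le)
  have hbN : b / N ≤ b₁ / N := div_le_div_of_nonneg_right hb hN0.le
  have hR' : |b / N| * (2 * ((d : ℝ) - 1)) ≤ R := by
    rw [hab]
    have : b / N * (2 * ((d : ℝ) - 1)) ≤ b₁ / N * (2 * ((d : ℝ) - 1)) := mul_le_mul_of_nonneg_right hbN (by linarith)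
    linarith
  have hcd : doorPoly d (K * |b / N|) < 1 := by
    rw [hab]
    exact doorPoly_lt_one_mono hd (mul_nonneg hK0 (div_nonneg h0 hN0.le)) (mul_le_mul_of_nonneg_left hbN hK0) hdoor
  have h := (StarDimMassGap.massGapAt_of_oneLinkKRModulus hd hN hK0 hR' hmod hcd).1
  have e : (N : ℝ) * (b / N) = b := mul_div_cancel₀ b hN0.ne'
  rwa [e] at h

end Window

end Summit.Ventures.YMGap.CouplingResponse

end
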